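import Literature.GroupTheory.CombinatorialGroupTheory.RandomSclFreeGroupNextBig
import HarnessLib

/-!
# Random rigidity of scl (Calegari–Walker 2013): proofs, part 35 — the real sides partition the
letters; the fan successor is transitive

D. Calegari, A. Walker, *Random rigidity in the free group*, Geom. Topol. 17 (2013)
[CalegariWalker2013], §4.4. Every letter position `y` of the cyclic word lies on exactly one side
leaving a big corner: `y = σ^j c` with `c` big and `1 ≤ j ≤ g c` (`g` the gap function); hence
`∑_{c big} g c = N`. And the fan successor `Sf` (part 33) reaches every valid pair from every
valid pair (so the resolved boundary is a single cycle).

* **`exists_owner`**, **`owner_unique`** — existence and uniqueness of the side through a letter.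
* **`sum_gap_eq`** — `∑_{c big} g c = N`.
* **`fan_reach`** — `Sf` is transitive on valid pairs.
-/

noncomputable section

namespace Literature.GroupTheory.CombinatorialGroupTheory

section FanCycle

open Equiv Finset

open scoped Classical

variable {N : ℕ} (π : Equiv.Perm (Fin N)) (g : Fin N → ℕ)
  (hg : ∀ x, ((finRotate N).trans π) (((finRotate N).trans π) x) ≠ x →
    1 ≤ g x ∧ (∀ j, 1 ≤ j → j ≤ g x - 1 →
      ((finRotate N).trans π) (((finRotate N).trans π) (((finRotate N) ^ j) x)) = ((finRotate N) ^ j) x) ∧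
    ((finRotate N).trans π) (((finRotate N).trans π) (((finRotate N) ^ (g x)) x)) ≠ ((finRotate N) ^ (g x)) x)

include hg in
/-- **Every letter lies on a side leaving a big corner.** If some corner is big, then for every
position `y` there are a big corner `c` and `1 ≤ j ≤ g c` with `σ^j c = y`.
(Arguments: `π g hg hN hex y`.) [cite: CalegariWalker2013, §4.4] -/
theorem exists_owner (hN : 0 < N)
    (hex : ∃ x, ((finRotate N).trans π) (((finRotate N).trans π) x) ≠ x) (y : Fin N) :
    ∃ c j, ((finRotate N).trans π) (((finRotate N).trans π) c) ≠ c ∧ 1 ≤ j ∧ j ≤ g c ∧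
      ((finRotate N) ^ j) c = y := by
  obtain ⟨x₀, hx₀⟩ := hex
  -- some `j ≥ 1` with `σ⁻ʲ y` big
  have hsome : ∃ j, 1 ≤ j ∧ ((finRotate N).trans π) (((finRotate N).trans π)
      (((finRotate N).symm ^ j) y)) ≠ ((finRotate N).symm ^ j) y := by
    set j := ((y : ℕ) + N - x₀) % N with hj
    have e : ((finRotate N) ^ j) x₀ = y := by
      apply Fin.ext
      rw [val_finRotate_pow hN, hj, Nat.add_mod_mod, show (x₀ : ℕ) + (y + N - x₀) = y + N by omega,
        Nat.add_mod_right, Nat.mod_eq_of_lt y.2]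
    have hjy : ((finRotate N).symm ^ j) y = x₀ := by rw [← e, symm_pow_apply_pow_self]
    rcases Nat.eq_zero_or_pos j with hj0 | hjpos
    · -- then `y = x₀`; use `j = N`
      rw [hj0, pow_zero, Equiv.Perm.one_apply] at hjy
      refine ⟨N, hN, ?_⟩
      have hNy : ((finRotate N).symm ^ N) y = y := by
        have h := pow_apply_symm_pow_self N y
        rw [finRotate_pow_self_apply hN] at h
        exact h
      rw [hNy, hjy]; exact hx₀
    · exact ⟨j, hjpos, by rw [hjy]; exact hx₀⟩
  -- the least such `j`
  set j₀ := Nat.find hsome with hj₀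
  obtain ⟨hj1, hbig⟩ := Nat.find_spec hsome
  set c := ((finRotate N).symm ^ j₀) y with hc
  refine ⟨c, j₀, hbig, hj1, ?_, pow_apply_symm_pow_self j₀ y⟩
  -- `j₀ ≤ g c` by minimality
  by_contra hlt
  push Not at hlt
  obtain ⟨hg1, _, hgbig⟩ := hg c hbig
  have e : ((finRotate N) ^ (g c)) c = ((finRotate N).symm ^ (j₀ - g c)) y := by
    rw [hc, pow_apply_symm_pow _ hlt.le]
  rw [e] at hgbig
  exact Nat.find_min hsome (show j₀ - g c < j₀ by omega) ⟨by omega, hgbig⟩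

include hg in
/-- **The side through a letter is unique.** (Arguments: `π g hg hc hc' hj hj' h`.)
[cite: CalegariWalker2013, §4.4] -/
theorem owner_unique {c c' : Fin N} {j j' : ℕ}
    (hc : ((finRotate N).trans π) (((finRotate N).trans π) c) ≠ c)
    (hc' : ((finRotate N).trans π) (((finRotate N).trans π) c') ≠ c')
    (hj : 1 ≤ j ∧ j ≤ g c) (hj' : 1 ≤ j' ∧ j' ≤ g c')
    (h : ((finRotate N) ^ j) c = ((finRotate N) ^ j') c') : c = c' ∧ j = j' := by
  -- if `j < j'` then `c = σ^{j'-j} c'` lies inside the side of `c'`, hence is bivalent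
  have key : ∀ {c c' : Fin N} {j j' : ℕ}, ((finRotate N).trans π) (((finRotate N).trans π) c) ≠ c →
      ((finRotate N).trans π) (((finRotate N).trans π) c') ≠ c' → 1 ≤ j → j' ≤ g c' →
      ((finRotate N) ^ j) c = ((finRotate N) ^ j') c' → ¬ j < j' := by
    intro c c' j j' hc hc' hj1 hj'g h hlt
    have e : c = ((finRotate N) ^ (j' - j)) c' := by
      have h2 := congrArg ((finRotate N).symm ^ j) h
      rw [symm_pow_apply_pow_self] at h2
      rw [h2, show j' = j + (j' - j) by omega, pow_add, Equiv.Perm.mul_apply,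
        symm_pow_apply_pow_self, show j + (j' - j) - j = j' - j by omega]
    have hbiv := (hg c' hc').2.1 (j' - j) (by omega) (by omega)
    rw [← e] at hbiv
    exact hc hbiv
  have h1 := key hc hc' hj.1 hj'.2 h
  have h2 := key hc' hc hj'.1 hj.2 h.symm
  have hjj : j = j' := by omega
  subst hjj
  exact ⟨((finRotate N) ^ j).injective h, rfl⟩

include hg in
/-- **The real sides partition the letters:** `∑_{c big} g c = N` (if some corner is big).
(Arguments: `π g hg hN hex`.) [cite: CalegariWalker2013, §4.4] -/
theorem sum_gap_eq (hN : 0 < N) (hex : ∃ x, ((finRotate N).trans π) (((finRotate N).trans π) x) ≠ x) :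
    ∑ c ∈ (Finset.univ : Finset (Fin N)).filter
        (fun c => ((finRotate N).trans π) (((finRotate N).trans π) c) ≠ c), g c = N := by
  -- the owner map
  have hown := exists_owner π g hg hN hex
  choose own jj hownbig hjj1 hjjg hjje using hown
  set BIG := (Finset.univ : Finset (Fin N)).filter
    (fun c => ((finRotate N).trans π) (((finRotate N).trans π) c) ≠ c) with hBIG
  have hmaps : ∀ y ∈ (Finset.univ : Finset (Fin N)), own y ∈ BIG := by
    intro y _; rw [hBIG, Finset.mem_filter]; exact ⟨Finset.mem_univ _, hownbig y⟩
  have hfib := Finset.card_eq_sum_card_fiberwise hmaps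
  rw [Finset.card_univ, Fintype.card_fin] at hfib
  conv_rhs => rw [hfib]
  refine Finset.sum_congr rfl fun c hcB => ?_
  rw [hBIG, Finset.mem_filter] at hcB
  obtain ⟨_, hc⟩ := hcB
  -- the fibre of `c` is `{σ^j c : 1 ≤ j ≤ g c}`
  have hgN : g c ≤ N := by
    -- `σ^N c = c` is big, so the gap is at most `N`
    by_contra hlt
    have := (hg c hc).2.1 N hN (by omega)
    rw [finRotate_pow_self_apply hN] at this
    exact hc this
  symm
  apply Finset.card_eq_of_bijective (fun i hi => ((finRotate N) ^ (i + 1)) c)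
  · intro y hy
    rw [Finset.mem_filter] at hy
    refine ⟨jj y - 1, by have := hjj1 y; have := hjjg y; rw [hy.2] at *; omega, ?_⟩
    rw [show jj y - 1 + 1 = jj y by have := hjj1 y; omega]
    conv_rhs => rw [← hjje y]
    rw [hy.2]
  · intro i hi
    rw [Finset.mem_filter]
    refine ⟨Finset.mem_univ _, ?_⟩
    have hu := owner_unique π g hg (hownbig (((finRotate N) ^ (i + 1)) c)) hc
      ⟨hjj1 _, hjjg _⟩ ⟨by omega, by omega⟩ (hjje _)
    exact hu.1
  · intro i j hi hj hij
    have h1 := congrArg Fin.val hij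
    rw [val_finRotate_pow hN, val_finRotate_pow hN] at h1
    -- `(c + i + 1) % N = (c + j + 1) % N` with `i, j < g c ≤ N`
    have hi' : i + 1 ≤ N := by omega
    have hj' : j + 1 ≤ N := by omega
    by_contra hne
    rcases Nat.lt_or_gt_of_ne hne with hlt | hlt
    · have : ((c : ℕ) + (j + 1)) % N = (((c : ℕ) + (i + 1)) + (j - i)) % N := by congr 1; omega
      rw [this] at h1
      have h2 := Nat.sub_mod_eq_zero_of_mod_eq h1.symm
      rw [Nat.add_sub_cancel_left] at h2
      have := Nat.eq_zero_of_dvd_of_lt (Nat.dvd_of_mod_eq_zero h2) (by omega)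
      omega
    · have : ((c : ℕ) + (i + 1)) % N = (((c : ℕ) + (j + 1)) + (i - j)) % N := by congr 1; omega
      rw [this] at h1
      have h2 := Nat.sub_mod_eq_zero_of_mod_eq h1
      rw [Nat.add_sub_cancel_left] at h2
      have := Nat.eq_zero_of_dvd_of_lt (Nat.dvd_of_mod_eq_zero h2) (by omega)
      omega

include hg in
/-- **The fan successor is transitive on valid pairs.** With `ff` the slot function, `nx x =
σ^{g x} x` and `Sf (x, s) = (x, s+1)` if `s < ff x`, else `(nx x, 0)`: for valid pairs `p, q`
(`p.1` big, `p.2 ≤ ff p.1`) some iterate of `Sf` maps `p` to `q`.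
(Arguments: `π g hg hN ff nx hnx Sf hSf hp hq`.) [cite: CalegariWalker2013, §4.4] -/
theorem fan_reach (hN : 0 < N) (ff : Fin N → ℕ) (nx : Fin N → Fin N)
    (hnx : ∀ x, nx x = ((finRotate N) ^ (g x)) x) (Sf : Fin N × ℕ → Fin N × ℕ)
    (hSf : ∀ p, Sf p = if p.2 < ff p.1 then (p.1, p.2 + 1) else (nx p.1, 0))
    {p q : Fin N × ℕ}
    (hp : ((finRotate N).trans π) (((finRotate N).trans π) p.1) ≠ p.1 ∧ p.2 ≤ ff p.1)
    (hq : ((finRotate N).trans π) (((finRotate N).trans π) q.1) ≠ q.1 ∧ q.2 ≤ ff q.1) :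
    ∃ k, Sf^[k] p = q := by
  -- climbing the slots
  have step1 : ∀ (x : Fin N) (s t : ℕ), s + t ≤ ff x → Sf^[t] (x, s) = (x, s + t) := by
    intro x s t
    induction t with
    | zero => intro _; simp
    | succ t ih =>
      intro hst
      rw [Function.iterate_succ_apply', ih (by omega), hSf]
      simp only
      rw [if_pos (by omega), Nat.add_assoc]
  -- leaving a corner
  have step2 : ∀ (x : Fin N) (s : ℕ), s ≤ ff x → Sf^[ff x - s + 1] (x, s) = (nx x, 0) := by
    intro x s hs
    rw [Function.iterate_succ_apply', step1 x s (ff x - s) (by omega), hSf]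
    simp only
    rw [if_neg (by omega)]
  -- along `nx`
  have hbig_nx : ∀ x, ((finRotate N).trans π) (((finRotate N).trans π) x) ≠ x →
      ((finRotate N).trans π) (((finRotate N).trans π) (nx x)) ≠ nx x := by
    intro x hx; rw [hnx]; exact (hg x hx).2.2
  have step3 : ∀ (m : ℕ) (x : Fin N), ((finRotate N).trans π) (((finRotate N).trans π) x) ≠ x →
      ∃ k, Sf^[k] (x, 0) = (nx^[m] x, 0) := by
    intro m
    induction m with
    | zero => intro x _; exact ⟨0, rfl⟩
    | succ m ih =>
      intro x hx
      obtain ⟨k, hk⟩ := ih (nx x) (hbig_nx x hx)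
      refine ⟨k + (ff x - 0 + 1), ?_⟩
      rw [Function.iterate_add_apply, step2 x 0 (Nat.zero_le _), hk, Function.iterate_succ_apply]
  obtain ⟨x, s⟩ := p
  obtain ⟨x', s'⟩ := q
  obtain ⟨hx, hs⟩ := hp
  obtain ⟨hx', hs'⟩ := hq
  simp only at hx hs hx' hs'
  -- `(x, s) ↦ (nx x, 0) ↦ (x', 0) ↦ (x', s')`
  obtain ⟨m, hm⟩ := next_reaches π g hg hN (hbig_nx x hx) hx'
  have hnxf : (fun w => ((finRotate N) ^ (g w)) w) = nx := funext fun w => (hnx w).symm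
  rw [hnxf] at hm
  obtain ⟨k, hk⟩ := step3 m (nx x) (hbig_nx x hx)
  rw [hm] at hk
  refine ⟨s' + (k + (ff x - s + 1)), ?_⟩
  rw [Function.iterate_add_apply, Function.iterate_add_apply, step2 x s hs, hk,
    step1 x' 0 s' (by omega), Nat.zero_add]

end FanCycle

end Literature.GroupTheory.CombinatorialGroupTheory

end
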